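import Literature.AlgebraicGeometry.Resolution.BlowupStrictTransform
import Literature.AlgebraicGeometry.Resolution.BlowupChartModule
import Literature.AlgebraicGeometry.Resolution.RegularCentreLocal
import Mathlib.RingTheory.Localization.LocalizationLocalization
import Mathlib.RingTheory.RegularLocalRing.Defs
import HarnessLib

/-!
# Blow-up charts commute with localisation of the base: `B[IB/a] = (A[I/a])_N` for `B = A_N`; regularity of the charts descends
# to every localisation (crux `FInjectiveMacaulayfication` stmt-ResolutionOfSingularities-15315, chain w45a; res-L1-w45a-plan-1 R16.56 —
# per-point half of the semi-local brick for res-L1-w45a-stub-1's `clusterGrowth_multi`; seat res-L1-w45a-stub-3 g7)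

[OURS · L1 W4.5a] Support file (`--supports stmt-ResolutionOfSingularities-15315 --as helper`); NOT a statement of any manuscript; def-free;
unconditional; AI-written (AI review is weaker than expert review).

SETTING. `A` a commutative ring, `N ⊆ A` a submonoid, `B` an `A`-algebra with `[IsLocalization N B]` (e.g. `A` = the semi-local ring `S` of
`…SemiLocalScheme`, `B = 𝒪_{X₁,ζ}` a local ring of it), `I ⊆ A` an ideal and `a ∈ I`. The tree's map of affine blow-up algebras
`blowupAlgebraMap (algebraMap A B) I (I·B) a : A[I/a] → B[IB/a]` (Literature `BlowupStrictTransform`) makes `B[IB/a]` an `A[I/a]`-algebra, and: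
* `coe_blowupAlgebraMap_div_pow` — it sends `r/aⁿ` to `r/aⁿ`;
* **`isLocalization_blowupAlgebraMap`** — `B[IB/a]` IS THE LOCALISATION of `A[I/a]` at the image of `N` («blowing up commutes with flat base
  change», here the localisation case, by hand on fractions `y/aⁿ`, `y ∈ Iⁿ`, Stacks 052Q);
* **`isRegularRing_blowupAlgebra_map`** — hence if the chart `A[I/a]` is a regular ring so is `B[IB/a]`;
* **`isRegularLocalRing_localization_blowupAlgebra_map`** — pointwise form: if every local ring of `A[I/a]` is regular, so is every local
  ring `(B[IB/a])_𝔔` — the currency of `DominatingLocFixLocal.exists_productCompatible_locFix_dimThree` («all chart primes regular»), so that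
  ONE regular blow-up over the semi-local scheme yields regular chart data at EACH of its closed points' local rings.
[folklore; cite: StacksProject, Tag 052Q; Tag 0805 (blowing up commutes with flat base change)] [cite: GortzWedhorn2020, Prop. 13.91 (2)]
-/

-- single-problem summit: the doubled namespace component is forced
set_option linter.dupNamespace false

noncomputable section

universe u

namespace Summit.ResolutionOfSingularities.ResolutionOfSingularities.Theorems.FInjectiveMacaulayfication.SemiLocalBlowupChart

open IsLocalization Literature.AlgebraicGeometry.Resolution

variable {A B : Type u} [CommRing A] [CommRing B] [Algebra A B] (N : Submonoid A) [IsLocalization N B] (I : Ideal A) (a : A)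

/-! ## §1 The chart map on fractions -/

omit [IsLocalization N B] in
/-- The map of blow-up algebras along `A → B` sends `r · (1/a)ⁿ` to `r · (1/a)ⁿ`. [folklore] -/
theorem awayMap_algebraMap_mul_invSelf_pow (r : A) (n : ℕ) :
    Localization.awayMap (algebraMap A B) a (algebraMap A (Localization.Away a) r * Away.invSelf a ^ n) =
      algebraMap B (Localization.Away (algebraMap A B a)) (algebraMap A B r) * Away.invSelf (algebraMap A B a) ^ n := by
  rw [map_mul, map_pow, awayMap_algebraMap, awayMap_invSelf]

/-- `(aᵐ/1) · (1/a)ᵐ⁺ⁿ = (1/a)ⁿ` in `A[1/a]`. [folklore] -/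
theorem algebraMap_pow_mul_invSelf_pow_add (m n : ℕ) :
    algebraMap A (Localization.Away a) (a ^ m) * Away.invSelf a ^ (m + n) = Away.invSelf a ^ n := by
  rw [pow_add, ← mul_assoc, algebraMap_pow_mul_invSelf_pow, one_mul]

/-- `(1/a)ᵐ · (aᵐ⁺ⁿ/1) = aⁿ/1` in `A[1/a]`. [folklore] -/
theorem invSelf_pow_mul_algebraMap_pow_add (m n : ℕ) :
    Away.invSelf a ^ m * algebraMap A (Localization.Away a) (a ^ (m + n)) = algebraMap A (Localization.Away a) (a ^ n) := by
  rw [pow_add, map_mul, ← mul_assoc, mul_comm (Away.invSelf a ^ m), algebraMap_pow_mul_invSelf_pow, one_mul]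

include N

/-! ## §2 `B[IB/a]` is the localisation of `A[I/a]` at `N` -/

/-- **Blow-up charts commute with localisation of the base.** For `B = A_N` and `a ∈ I`, the affine blow-up algebra `B[IB/a]` is the
localisation of `A[I/a]` at (the image of) `N`, the algebra structure being the natural chart map `A[I/a] → B[IB/a]`.
[cite: StacksProject, Tag 052Q; Tag 0805] -/
theorem isLocalization_blowupAlgebraMap (ha : a ∈ I) :
    letI : Algebra (blowupAlgebra I a) (blowupAlgebra (I.map (algebraMap A B)) (algebraMap A B a)) :=
      (blowupAlgebraMap (algebraMap A B) I (I.map (algebraMap A B)) a le_rfl).toAlgebra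
    IsLocalization (N.map (algebraMap A (blowupAlgebra I a))) (blowupAlgebra (I.map (algebraMap A B)) (algebraMap A B a)) := by
  letI : Algebra (blowupAlgebra I a) (blowupAlgebra (I.map (algebraMap A B)) (algebraMap A B a)) :=
    (blowupAlgebraMap (algebraMap A B) I (I.map (algebraMap A B)) a le_rfl).toAlgebra
  have hφ : ∀ z : blowupAlgebra I a, ((algebraMap (blowupAlgebra I a) (blowupAlgebra (I.map (algebraMap A B)) (algebraMap A B a)) z :
      Localization.Away (algebraMap A B a)) = Localization.awayMap (algebraMap A B) a z) := fun z => rfl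
  have haB : algebraMap A B a ∈ I.map (algebraMap A B) := Ideal.mem_map_of_mem _ ha
  refine (isLocalization_iff _ _).mpr ⟨?_, ?_, ?_⟩
  · -- units: `n ∈ N` is a unit of `B`, hence of `B[IB/a]`
    rintro ⟨_, n, hn, rfl⟩
    have h1 : algebraMap (blowupAlgebra I a) (blowupAlgebra (I.map (algebraMap A B)) (algebraMap A B a))
        (algebraMap A (blowupAlgebra I a) n) = algebraMap B _ (algebraMap A B n) :=
      blowupAlgebraMap_algebraMap (algebraMap A B) I (I.map (algebraMap A B)) a le_rfl n
    rw [h1]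
    exact (IsLocalization.map_units B ⟨n, hn⟩).map _
  · -- surjectivity: `z = y/aⁿ`, `y ∈ (IB)ⁿ = IⁿB`, `y · m = r` with `r ∈ Iⁿ`, `m ∈ N`; then `z · m = (r/aⁿ)`
    intro z
    obtain ⟨n, y, hy, hz⟩ := blowupAlgebra.exists_eq_mul_invSelf_pow (I.map (algebraMap A B)) (algebraMap A B a) haB z.2
    rw [← Ideal.map_pow] at hy
    obtain ⟨⟨⟨r, hr⟩, ⟨m, hm⟩⟩, hyr⟩ := (IsLocalization.mem_map_algebraMap_iff N B).mp hy
    simp only at hyr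
    refine ⟨⟨⟨algebraMap A (Localization.Away a) r * Away.invSelf a ^ n, algebraMap_mul_invSelf_pow_mem_blowupAlgebra (I := I) (a := a) n hr⟩,
      ⟨algebraMap A (blowupAlgebra I a) m, m, hm, rfl⟩⟩, ?_⟩
    apply Subtype.ext
    simp only [Subalgebra.coe_mul, hφ, awayMap_algebraMap_mul_invSelf_pow]
    rw [hz, Subalgebra.coe_algebraMap, awayMap_algebraMap, mul_right_comm, ← map_mul, hyr]
  · -- equalities come from `N`: clear the denominators in `B[1/a]`, then in `B`, then in `A`
    intro z₁ z₂ h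
    obtain ⟨n₁, r₁, -, hz₁⟩ := blowupAlgebra.exists_eq_mul_invSelf_pow I a ha z₁.2
    obtain ⟨n₂, r₂, -, hz₂⟩ := blowupAlgebra.exists_eq_mul_invSelf_pow I a ha z₂.2
    have h' := congrArg Subtype.val h
    simp only [hφ, hz₁, hz₂, awayMap_algebraMap_mul_invSelf_pow] at h'
    -- multiply by `a^(n₁+n₂)` in `B[1/a]`
    have hB : algebraMap B (Localization.Away (algebraMap A B a)) (algebraMap A B (r₁ * a ^ n₂)) =
        algebraMap B (Localization.Away (algebraMap A B a)) (algebraMap A B (r₂ * a ^ n₁)) := by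
      have h'' : algebraMap B (Localization.Away (algebraMap A B a)) (algebraMap A B r₁) * Away.invSelf (algebraMap A B a) ^ n₁ *
          algebraMap B (Localization.Away (algebraMap A B a)) (algebraMap A B a ^ (n₁ + n₂)) =
          algebraMap B (Localization.Away (algebraMap A B a)) (algebraMap A B r₂) * Away.invSelf (algebraMap A B a) ^ n₂ *
          algebraMap B (Localization.Away (algebraMap A B a)) (algebraMap A B a ^ (n₁ + n₂)) := by rw [h']
      rwa [mul_assoc, mul_assoc, invSelf_pow_mul_algebraMap_pow_add, add_comm n₁ n₂, invSelf_pow_mul_algebraMap_pow_add,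
        ← map_mul, ← map_mul, ← map_pow (algebraMap A B), ← map_pow (algebraMap A B), ← map_mul (algebraMap A B),
        ← map_mul (algebraMap A B)] at h''
    obtain ⟨⟨_, k, rfl⟩, hk⟩ := (IsLocalization.eq_iff_exists (Submonoid.powers (algebraMap A B a)) _).mp hB
    simp only [← map_pow, ← map_mul] at hk
    obtain ⟨⟨m, hm⟩, hmk⟩ := (IsLocalization.eq_iff_exists N B).mp hk
    simp only at hmk
    refine ⟨⟨algebraMap A (blowupAlgebra I a) m, m, hm, rfl⟩, Subtype.ext ?_⟩
    simp only [Subalgebra.coe_mul, Subalgebra.coe_algebraMap, hz₁, hz₂]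
    -- `m r₁ / a^{n₁} = m a^k r₁ a^{n₂} / a^{k+n₂+n₁} = m a^k r₂ a^{n₁} / a^{k+n₁+n₂} = m r₂ / a^{n₂}`
    have f1 : algebraMap A (Localization.Away a) m * (algebraMap A _ r₁ * Away.invSelf a ^ n₁) =
        algebraMap A _ (m * (a ^ k * (r₁ * a ^ n₂))) * Away.invSelf a ^ (k + n₂ + n₁) := by
      rw [show m * (a ^ k * (r₁ * a ^ n₂)) = (m * r₁) * a ^ (k + n₂) by ring, map_mul (algebraMap A _) (m * r₁), mul_assoc,
        algebraMap_pow_mul_invSelf_pow_add, map_mul, mul_assoc]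
    have f2 : algebraMap A (Localization.Away a) m * (algebraMap A _ r₂ * Away.invSelf a ^ n₂) =
        algebraMap A _ (m * (a ^ k * (r₂ * a ^ n₁))) * Away.invSelf a ^ (k + n₁ + n₂) := by
      rw [show m * (a ^ k * (r₂ * a ^ n₁)) = (m * r₂) * a ^ (k + n₁) by ring, map_mul (algebraMap A _) (m * r₂), mul_assoc,
        algebraMap_pow_mul_invSelf_pow_add, map_mul, mul_assoc]
    rw [f1, f2, hmk, show k + n₂ + n₁ = k + n₁ + n₂ by ring]

/-! ## §3 Regularity descends to the localised charts -/

/-- **If the chart `A[I/a]` is a regular ring, so is `B[IB/a]`** for every localisation `B` of `A` (`a ∈ I`). [folklore] -/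
theorem isRegularRing_blowupAlgebra_map (ha : a ∈ I) [IsRegularRing (blowupAlgebra I a)] :
    IsRegularRing (blowupAlgebra (I.map (algebraMap A B)) (algebraMap A B a)) := by
  letI : Algebra (blowupAlgebra I a) (blowupAlgebra (I.map (algebraMap A B)) (algebraMap A B a)) :=
    (blowupAlgebraMap (algebraMap A B) I (I.map (algebraMap A B)) a le_rfl).toAlgebra
  haveI := isLocalization_blowupAlgebraMap (B := B) N I a ha
  exact isRegularRing_of_isLocalization (N.map (algebraMap A (blowupAlgebra I a))) _

/-- **Pointwise form**: if every local ring of the chart `A[I/a]` is regular (the chart ring being Noetherian), then every local ring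
`(B[IB/a])_𝔔` of the localised chart is regular. [folklore] -/
theorem isRegularLocalRing_localization_blowupAlgebra_map (ha : a ∈ I) [IsNoetherianRing (blowupAlgebra I a)]
    (hreg : ∀ 𝔓 : PrimeSpectrum (blowupAlgebra I a), IsRegularLocalRing (Localization.AtPrime 𝔓.asIdeal))
    (𝔔 : PrimeSpectrum (blowupAlgebra (I.map (algebraMap A B)) (algebraMap A B a))) :
    IsRegularLocalRing (Localization.AtPrime 𝔔.asIdeal) := by
  haveI : IsRegularRing (blowupAlgebra I a) := isRegularRing_iff.mpr fun 𝔓 h𝔓 => hreg ⟨𝔓, h𝔓⟩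
  haveI := isRegularRing_blowupAlgebra_map (B := B) N I a ha
  exact IsRegularRing.isRegularLocalRing_localization 𝔔.asIdeal

/-- The localised chart is Noetherian when the chart is. [folklore] -/
theorem isNoetherianRing_blowupAlgebra_map (ha : a ∈ I) [IsNoetherianRing (blowupAlgebra I a)] :
    IsNoetherianRing (blowupAlgebra (I.map (algebraMap A B)) (algebraMap A B a)) := by
  letI : Algebra (blowupAlgebra I a) (blowupAlgebra (I.map (algebraMap A B)) (algebraMap A B a)) :=
    (blowupAlgebraMap (algebraMap A B) I (I.map (algebraMap A B)) a le_rfl).toAlgebra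
  haveI := isLocalization_blowupAlgebraMap (B := B) N I a ha
  exact IsLocalization.isNoetherianRing (N.map (algebraMap A (blowupAlgebra I a))) _ inferInstance

end Summit.ResolutionOfSingularities.ResolutionOfSingularities.Theorems.FInjectiveMacaulayfication.SemiLocalBlowupChart

end
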